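import Summits.Ventures.PercRepro.ExcessOneSelfDualBridge
import Summits.Ventures.PercRepro.ExcessOneCompletion

/-!
# A residue instance of Conjecture V contains neither `∅` nor `univ`

A *residue instance* of Conjecture V (`ConjV`, ThetaTwoPairs.lean) is a family `F` with no
complementary pair, of MS-excess one (`|F \\ F| = |F| + 1`), with a near-member `u`
(`u, uᶜ ∉ F`, every member A-signable — `t ∩ u, tᶜ ∩ uᶜ` differences — or C*-signable —
`t \ u, u \ t` differences) such that neither `F ∪ {u}` nor `F ∪ {uᶜ}` is tight.

**Theorem.** A residue instance has `∅ ∉ F` and `univ ∉ F` (`empty_notMem_of_residue`,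
`univ_notMem_of_residue`). Paper: proofs/MINE1-theoremS.md, Addendum 15.

*Proof of `∅ ∉ F`.* If `∅ ∈ F` then every member is a difference (`t = t \ ∅`), so
`F \\ F = insert x₀ F` for a single non-member `x₀`; the signability of `∅` puts `uᶜ` or `u`
among the differences, so `x₀ = uᶜ` or `x₀ = u`. The core lemma
(`forall_cells_compl_of_empty_mem`, stated for `w = x₀`) then shows that **every** member is
A-signable (for `x₀ = uᶜ`; C*-signable for `x₀ = u`): a member `t ⊉ w` has both parts `t \ w`,
`t ∩ w` in `F` (one part is a required cell, the other is the difference of `t` with it — and the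
only non-member difference is `w` itself); a member `t ⊇ w` cannot be C*-signable, because its
required cell `wᶜ \ t = tᶜ` would be a member complementary to `t`; and `w \ t` is a difference
for every member `t`, read off from `t₁ \ t` where `t₁ ⊇ w` is a member (`w` is a difference).
Hence `F ∪ {uᶜ}` (resp. `F ∪ {u}`) is tight (`tight_insert_iff_of_excess_one`) — contradiction.
The `univ` half is the same statement for the complement family (`compls F`), which is again a
residue instance for the same `u` (`diffs_compls`, `tight_compls_iff`, `compls_insert`).

**Consequence** (`conjV_of_forall_good'`): Conjecture V follows from «every member of a residue
instance is a difference or a co-difference» alone — the side conditions `∅, univ ∉ F` of the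
bridge `conjV_of_forall_good` (ExcessOneSelfDualBridge.lean) are automatic.
-/

namespace PercRepro.MSTight

open Finset
open scoped FinsetFamily

variable {α : Type*} [DecidableEq α] [Fintype α]

section Compls

/-- The complement family has the same differences: `tᶜ \ sᶜ = s \ t`. -/
theorem diffs_compls (F : Finset (Finset α)) : compls F \\ compls F = F \\ F := by
  ext x
  simp only [mem_diffs, mem_compls]
  constructor
  · rintro ⟨t, ht, s, hs, rfl⟩
    refine ⟨Finset.univ \ s, hs, Finset.univ \ t, ht, ?_⟩
    ext a
    simp only [mem_sdiff, mem_univ, true_and, not_not]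
    tauto
  · rintro ⟨t, ht, s, hs, rfl⟩
    refine ⟨Finset.univ \ s, by rwa [Finset.sdiff_sdiff_eq_self (subset_univ s)],
      Finset.univ \ t, by rwa [Finset.sdiff_sdiff_eq_self (subset_univ t)], ?_⟩
    ext a
    simp only [mem_sdiff, mem_univ, true_and, not_not]
    tauto

/-- Complementing a family commutes with adjoining a set. -/
theorem compls_insert (x : Finset α) (F : Finset (Finset α)) :
    compls (insert x F) = insert (Finset.univ \ x) (compls F) := by
  ext t
  simp only [mem_compls, mem_insert]
  constructor
  · rintro (h | h)
    · left
      rw [← h, Finset.sdiff_sdiff_eq_self (subset_univ t)]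
    · exact Or.inr h
  · rintro (rfl | h)
    · left
      exact Finset.sdiff_sdiff_eq_self (subset_univ x)
    · exact Or.inr h

/-- A family is tight iff its complement family is. -/
theorem tight_compls_iff (F : Finset (Finset α)) : Tight (compls F) ↔ Tight F := by
  unfold Tight
  rw [diffs_compls, card_compls]

end Compls

section Core

variable {F : Finset (Finset α)} {w : Finset α}

omit [Fintype α] in
/-- When `F \\ F = insert w F`, every difference other than `w` is a member. -/
theorem mem_of_mem_diffs_of_ne (hD : F \\ F = insert w F) {x : Finset α} (hx : x ∈ F \\ F)
    (hxw : x ≠ w) : x ∈ F := by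
  rw [hD] at hx
  rcases mem_insert.1 hx with rfl | hx
  · exact absurd rfl hxw
  · exact hx

/-- **The core lemma.** Let `∅ ∈ F`, let `F` have no complementary pair, let the differences of
`F` be the members together with one non-member `w`, and let every member be A-signable or
C*-signable for the set `wᶜ` (A-cells `t \ w`, `w \ t`; C*-cells `t ∩ w`, `wᶜ \ t`). Then every
member is A-signable for `wᶜ`. -/
theorem forall_cells_compl_of_empty_mem (h0 : (∅ : Finset α) ∈ F)
    (hval : ∀ t ∈ F, Finset.univ \ t ∉ F) (hD : F \\ F = insert w F) (hw : w ∉ F)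
    (hsign : ∀ t ∈ F, Cells (F \\ F) t (Finset.univ \ w) ∨ Cells (F \\ F) t w) :
    ∀ t ∈ F, Cells (F \\ F) t (Finset.univ \ w) := by
  have hw0 : w ≠ ∅ := fun h => hw (h ▸ h0)
  have hdiff : ∀ t ∈ F, ∀ s ∈ F, t \ s ∈ F \\ F := fun t ht s hs =>
    mem_diffs.2 ⟨t, ht, s, hs, rfl⟩
  have hmemD : ∀ x ∈ F, x ∈ F \\ F := fun x hx => by
    have := hdiff x hx ∅ h0
    rwa [Finset.sdiff_empty] at this
  have h0D : (∅ : Finset α) ∈ F \\ F := hmemD ∅ h0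
  -- a difference disjoint from `w` is a member
  have hdis : ∀ x ∈ F \\ F, x ∩ w = ∅ → x ∈ F := by
    intro x hx hxw
    refine mem_of_mem_diffs_of_ne hD hx fun h => hw0 ?_
    rw [h, inter_self] at hxw
    exact hxw
  -- `w` is a difference: some member `t₁` contains it
  have hwD : w ∈ F \\ F := by
    rw [hD]
    exact mem_insert_self _ _
  obtain ⟨t₁, ht₁, s₁, -, hts₁⟩ := mem_diffs.1 hwD
  have hwt₁ : w ⊆ t₁ := by
    rw [← hts₁]
    exact sdiff_subset
  -- Claim A: a member not containing `w` has both parts in `F`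
  have hA : ∀ t ∈ F, ¬ w ⊆ t → t \ w ∈ F ∧ t ∩ w ∈ F := by
    intro t ht hnot
    have hne : t ∩ w ≠ w := fun h => hnot (by rw [← h]; exact inter_subset_left)
    rcases hsign t ht with hc | hc
    · rw [cellsC_iff_sdiff] at hc
      have h1 : t \ w ∈ F := hdis _ hc.2 (sdiff_inter_self w t)
      have h2 : t ∩ w ∈ F := by
        rw [← sdiff_sdiff_self_left]
        exact mem_of_mem_diffs_of_ne hD (hdiff t ht _ h1) (by rwa [sdiff_sdiff_self_left])
      exact ⟨h1, h2⟩
    · have h2 : t ∩ w ∈ F := mem_of_mem_diffs_of_ne hD hc.1 hne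
      have h1 : t \ w ∈ F := by
        rw [← sdiff_inter_self_left]
        exact hdis _ (hdiff t ht _ h2) (by rw [sdiff_inter_self_left]; exact sdiff_inter_self w t)
      exact ⟨h1, h2⟩
  -- Claim B: a member containing `w` is A-signable (it cannot be C*-signable: validity)
  have hB : ∀ t ∈ F, w ⊆ t → Cells (F \\ F) t (Finset.univ \ w) := by
    intro t ht hwt
    rw [cellsC_iff_sdiff]
    refine ⟨?_, ?_⟩
    · rw [sdiff_eq_empty_iff_subset.2 hwt]
      exact h0D
    · rcases hsign t ht with hc | hc
      · exact (cellsC_iff_sdiff.1 hc).2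
      · exfalso
        obtain ⟨-, hc2⟩ := hc
        have e : (Finset.univ \ t) ∩ (Finset.univ \ w) = Finset.univ \ t := by
          ext a
          simp only [mem_inter, mem_sdiff, mem_univ, true_and]
          exact ⟨fun h => h.1, fun h => ⟨h, fun hw' => h (hwt hw')⟩⟩
        rw [e] at hc2
        refine hval t ht (hdis _ hc2 ?_)
        ext a
        simp only [mem_inter, mem_sdiff, mem_univ, true_and, notMem_empty, iff_false, not_and]
        exact fun h hw' => h (hwt hw')
  -- Claim C: `w \ t` is a difference for every member `t` not containing `w`
  have hC : ∀ t ∈ F, ¬ w ⊆ t → w \ t ∈ F \\ F := by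
    intro t ht hnot
    have ht₂ : t₁ \ t ∈ F \\ F := hdiff t₁ ht₁ t ht
    have e : w \ t = (t₁ \ t) ∩ w := by
      ext a
      simp only [mem_sdiff, mem_inter]
      constructor
      · rintro ⟨h1, h2⟩
        exact ⟨⟨hwt₁ h1, h2⟩, h1⟩
      · rintro ⟨⟨-, h2⟩, h1⟩
        exact ⟨h1, h2⟩
    rw [e]
    by_cases hw2 : w ⊆ t₁ \ t
    · rw [inter_eq_right.2 hw2]
      exact hwD
    · have ht₂F : t₁ \ t ∈ F := mem_of_mem_diffs_of_ne hD ht₂ fun h => hw2 (by rw [h])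
      exact hmemD _ (hA _ ht₂F hw2).2
  -- conclusion
  intro t ht
  by_cases hwt : w ⊆ t
  · exact hB t ht hwt
  · rw [cellsC_iff_sdiff]
    exact ⟨hC t ht hwt, hmemD _ (hA t ht hwt).1⟩

end Core

section Residue

variable {F : Finset (Finset α)} {σ : Finset α → Bool} {u : Finset α}

/-- **A residue instance does not contain `∅`.** -/
theorem empty_notMem_of_residue (hval : Disjoint F (compls F))
    (hex : (F \\ F).card = F.card + 1) (hu : u ∉ F) (huc : Finset.univ \ u ∉ F)
    (hcells : ∀ t ∈ F, Cells (F \\ F) t (if σ t = true then u else Finset.univ \ u))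
    (hnt : ¬ Tight (insert u F)) (hntc : ¬ Tight (insert (Finset.univ \ u) F)) :
    (∅ : Finset α) ∉ F := by
  intro h0
  have hval' : ∀ t ∈ F, Finset.univ \ t ∉ F := fun t ht h =>
    Finset.disjoint_left.1 hval ht (mem_compls.2 h)
  -- every member is a difference, so the differences are `F` plus one non-member `x₀`
  have hFD : F ⊆ F \\ F := fun x hx => mem_diffs.2 ⟨x, hx, ∅, h0, Finset.sdiff_empty⟩
  have hcard : ((F \\ F) \ F).card = 1 := by
    rw [card_sdiff_of_subset hFD, hex]
    omega
  obtain ⟨x₀, hx₀⟩ := card_eq_one.1 hcard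
  have hx₀D : x₀ ∈ (F \\ F) \ F := by
    rw [hx₀]
    exact mem_singleton_self _
  have hx₀F : x₀ ∉ F := (mem_sdiff.1 hx₀D).2
  have huniq : ∀ x ∈ F \\ F, x ∉ F → x = x₀ := fun x hx hxF => by
    have : x ∈ (F \\ F) \ F := mem_sdiff.2 ⟨hx, hxF⟩
    rw [hx₀] at this
    exact mem_singleton.1 this
  have hD : F \\ F = insert x₀ F := by
    ext x
    constructor
    · intro hx
      by_cases hxF : x ∈ F
      · exact mem_insert_of_mem hxF
      · exact mem_insert.2 (Or.inl (huniq x hx hxF))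
    · intro hx
      rcases mem_insert.1 hx with rfl | hx
      · exact (mem_sdiff.1 hx₀D).1
      · exact hFD hx
  -- signability without the sign pattern
  have hsign : ∀ t ∈ F, Cells (F \\ F) t u ∨ Cells (F \\ F) t (Finset.univ \ u) := by
    intro t ht
    have := hcells t ht
    by_cases hσ : σ t = true
    · left
      simpa [hσ] using this
    · right
      simpa [hσ] using this
  -- the signability of `∅` pins `x₀` to `uᶜ` or `u`
  have hx₀' : x₀ = Finset.univ \ u ∨ x₀ = u := by
    rcases hsign ∅ h0 with ⟨-, h2⟩ | ⟨-, h2⟩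
    · left
      rw [Finset.sdiff_empty, univ_inter] at h2
      exact (huniq _ h2 huc).symm
    · right
      rw [Finset.sdiff_empty, univ_inter, Finset.sdiff_sdiff_eq_self (subset_univ u)] at h2
      exact (huniq _ h2 hu).symm
  rcases hx₀' with rfl | rfl
  · -- `x₀ = uᶜ`: every member is A-signable, so `F ∪ {uᶜ}` is tight
    apply hntc
    rw [tight_insert_iff_of_excess_one hex huc]
    intro t ht
    have h := forall_cells_compl_of_empty_mem h0 hval' hD hx₀F
      (fun t ht => by rw [Finset.sdiff_sdiff_eq_self (subset_univ u)]; exact hsign t ht) t ht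
    rw [Finset.sdiff_sdiff_eq_self (subset_univ u)] at h
    exact cellsA_iff_sdiff.1 h
  · -- `x₀ = u`: every member is C*-signable, so `F ∪ {u}` is tight
    apply hnt
    rw [tight_insert_iff_of_excess_one hex hu]
    intro t ht
    have h := forall_cells_compl_of_empty_mem h0 hval' hD hx₀F
      (fun t ht => (hsign t ht).symm) t ht
    exact cellsC_iff_sdiff.1 h

/-- **A residue instance does not contain `univ`**: the complement family is a residue instance
for the same `u` (with the signs exchanged), and it would contain `∅`. -/
theorem univ_notMem_of_residue (hval : Disjoint F (compls F))
    (hex : (F \\ F).card = F.card + 1) (hu : u ∉ F) (huc : Finset.univ \ u ∉ F)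
    (hcells : ∀ t ∈ F, Cells (F \\ F) t (if σ t = true then u else Finset.univ \ u))
    (hnt : ¬ Tight (insert u F)) (hntc : ¬ Tight (insert (Finset.univ \ u) F)) :
    (Finset.univ : Finset α) ∉ F := by
  intro hU
  have h0 : (∅ : Finset α) ∈ compls F := mem_compls.2 (by rwa [Finset.sdiff_empty])
  refine empty_notMem_of_residue (F := compls F) (σ := fun t => !σ (Finset.univ \ t)) (u := u)
    ?_ ?_ ?_ ?_ ?_ ?_ ?_ h0
  · rw [Finset.disjoint_left]
    intro x hx hx'
    rw [mem_compls] at hx hx'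
    rw [mem_compls, Finset.sdiff_sdiff_eq_self (subset_univ x)] at hx'
    exact Finset.disjoint_left.1 hval hx' (mem_compls.2 hx)
  · rw [diffs_compls, card_compls]
    exact hex
  · rw [mem_compls]
    exact huc
  · rw [mem_compls, Finset.sdiff_sdiff_eq_self (subset_univ u)]
    exact hu
  · intro t ht
    rw [diffs_compls]
    obtain ⟨s, hs, rfl⟩ := mem_image.1 ht
    have hc := hcells s hs
    rw [Finset.sdiff_sdiff_eq_self (subset_univ s)]
    by_cases hσ : σ s = true
    · rw [if_pos hσ] at hc
      rw [hσ, Bool.not_true, if_neg Bool.false_ne_true, cells_compl_iff]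
      exact hc
    · rw [if_neg hσ] at hc
      rw [Bool.not_eq_true] at hσ
      rw [hσ, Bool.not_false, if_pos rfl]
      have h' := (cells_compl_iff (F \\ F) s (Finset.univ \ u)).2 hc
      rwa [Finset.sdiff_sdiff_eq_self (subset_univ u)] at h'
  · intro h
    apply hntc
    rw [← tight_compls_iff, compls_insert, Finset.sdiff_sdiff_eq_self (subset_univ u)]
    exact h
  · intro h
    apply hnt
    rw [← tight_compls_iff, compls_insert]
    exact h

/-- **The reduction, sharpened.** Conjecture V follows from «every member of a residue instance
is a difference or a co-difference» — the degenerate members `∅`, `univ` are excluded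
automatically (`empty_notMem_of_residue`, `univ_notMem_of_residue`). -/
theorem conjV_of_forall_good'
    (hT2 : ∀ (F : Finset (Finset α)) (σ : Finset α → Bool) (u : Finset α),
      Disjoint F (compls F) → (F \\ F).card = F.card + 1 → u ∉ F → Finset.univ \ u ∉ F →
      (∀ t ∈ F, Cells (F \\ F) t (if σ t = true then u else Finset.univ \ u)) →
      ¬ Tight (insert u F) → ¬ Tight (insert (Finset.univ \ u) F) →
      ∀ t ∈ F, t ∈ F \\ F ∨ Finset.univ \ t ∈ F \\ F) :
    ConjV α := by
  refine conjV_of_forall_good fun F σ u hval hex hu huc hcells hnt hntc => ?_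
  exact ⟨empty_notMem_of_residue hval hex hu huc hcells hnt hntc,
    univ_notMem_of_residue hval hex hu huc hcells hnt hntc,
    hT2 F σ u hval hex hu huc hcells hnt hntc⟩

end Residue

end PercRepro.MSTight
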